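import Summits.CriticalPhenomena.SAWScalingLimit.Theorems.BoundaryClosureNegative_Instance

/-!
# Negative knowledge on crux `BoundaryClosureR` (stmt-CriticalPhenomena-14004), part 2/5: peeling a
dead-end vertex from the FAR (normalisation) side

If `t ∉ Λ` is attached to `Λ` through a single neighbour `w ∈ Λ` (every other neighbour of `t` lying
outside `Λ' = insert t Λ`), then for a root mid-edge `a ∌ t` of `Λ`:
* (invisibility, `observable_insert_of_deadEnd`) at every mid-edge `z ∌ t` the observables of `Λ'` and
  `Λ` from `a` coincide — no self-avoiding walk passes through the dead end `t`
  (`not_mem_verts_of_deadEnd`);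
* (tip, `observable_insert_tip`) at the new tip mid-edge `{u, t}` (`u ∉ Λ'` the outer neighbour) the
  observable of `Λ'` is `x e^{-iσθ}` times the observable of `Λ` at the old boundary mid-edge `{w, t}`:
  walks to the tip are the walks to `{w, t}` extended by `t` (`verts_eq_of_tip`); lengths grow by one,
  windings by the last turning angle `θ` (`winding_concat_right_ray`, `winding_concat₃`).
Mirror image of `BoundaryClosure.Negative.observable_insert` (root side).  Everything proved. [folklore]
-/

noncomputable section

open Set Filter Topology Complex
open Literature.Probability.RandomPlanarGeometry
open UpperHalfPlane (upperHalfPlaneSet)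
open Literature.Probability.LatticeModels Literature.Probability.RandomPlanarGeometry.SAW

namespace Summit.CriticalPhenomena.SAWScalingLimit.Theorems.BoundaryClosureR.Negative

open BoundaryClosure.Negative

section EdgeList

variable {V : Type*}

/-- The consecutive pairs of `L ++ [p, q]`: those of `L ++ [p]`, then `{p, q}`. [folklore] -/
theorem edges_concat_concat : ∀ (L : List V) (p q : V),
    List.zipWith (fun u w => s(u, w)) (L ++ [p, q]) (L ++ [p, q]).tail =
      List.zipWith (fun u w => s(u, w)) (L ++ [p]) (L ++ [p]).tail ++ [s(p, q)]
  | [], _, _ => rfl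
  | [_], _, _ => rfl
  | x :: y :: L, p, q => by
    have ih := edges_concat_concat (y :: L) p q
    simp only [List.cons_append] at ih ⊢
    rw [edges_cons_cons, edges_cons_cons, ih]
    rfl

/-- A chain ending `…, p, q` relates `p` and `q`. [folklore] -/
theorem rel_of_isChain_concat_concat {R : V → V → Prop} :
    ∀ (L : List V) (p q : V), List.IsChain R (L ++ [p, q]) → R p q
  | [], _, _, h => List.isChain_pair.1 h
  | x :: L, p, q, h => rel_of_isChain_concat_concat L p q (by
      rw [List.cons_append] at h; exact h.tail)

end EdgeList

section PeelEnd

variable {Λ : Finset HexVertex} {t w u : HexVertex} {a z : Sym2 HexVertex}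

/-- **No walk passes through a dead end**: if `t`'s only neighbour in `insert t Λ` is `w`, a
self-avoiding walk of `insert t Λ` from `a ∌ t` to `z ∌ t` does not visit `t`. [folklore] -/
theorem not_mem_verts_of_deadEnd (hclosed : ∀ v ∈ insert t Λ, hexGraph.Adj t v → v = w)
    (hta : t ∉ a) (htz : t ∉ z) (γ : HexMidEdgeSAW (insert t Λ) a z) : t ∉ γ.verts := by
  intro ht
  obtain ⟨L₁, L₂, hL⟩ := List.append_of_mem ht
  rcases L₂ with _ | ⟨v, L₂⟩
  · -- `t` is the last vertex, hence on `z`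
    apply htz
    apply γ.getLast_mem t
    rw [hL, List.getLast?_append_of_ne_nil _ (List.cons_ne_nil _ _)]; rfl
  · -- the next vertex is `w`
    have hc := γ.isChain
    rw [hL] at hc
    have htv : hexGraph.Adj t v := (List.isChain_append_cons_cons.1 hc).2.1
    have hv : v = w := hclosed v (γ.subset v (by rw [hL]; simp)) htv
    subst hv
    rcases L₁.eq_nil_or_concat' with h₁ | ⟨L₁, p, rfl⟩
    · -- `t` is the first vertex, hence on `a`
      subst h₁
      apply hta
      apply γ.head_mem t
      rw [hL]; rfl
    · -- the previous vertex is `w` as well: `w` is visited twice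
      have hpt : hexGraph.Adj p t := by
        have hc' : List.IsChain hexGraph.Adj (L₁ ++ p :: t :: (v :: L₂)) := by
          simpa [List.append_assoc] using hc
        exact (List.isChain_append_cons_cons.1 hc').2.1
      have hp : p = v := hclosed p (γ.subset p (by rw [hL]; simp)) hpt.symm
      subst hp
      have hnd := γ.nodup
      rw [hL] at hnd
      have hdis := List.disjoint_of_nodup_append hnd
      exact hdis (by simp) (by simp : p ∈ t :: p :: L₂)

/-- **Invisibility of a dead end**: at every mid-edge `z ∌ t` the observables of `insert t Λ` and of
`Λ` from a root mid-edge `a ∌ t` of `Λ` coincide. [folklore] -/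
theorem observable_insert_of_deadEnd (hclosed : ∀ v ∈ insert t Λ, hexGraph.Adj t v → v = w)
    (hta : t ∉ a) (htz : t ∉ z) (haΛ : a ∈ hexDomainMidEdges Λ) (x σ : ℝ) :
    hexParafermionicObservable (insert t Λ) a x σ z = hexParafermionicObservable Λ a x σ z := by
  have key := fun γ : HexMidEdgeSAW (insert t Λ) a z => not_mem_verts_of_deadEnd hclosed hta htz γ
  let e : HexMidEdgeSAW (insert t Λ) a z ≃ HexMidEdgeSAW Λ a z :=
    { toFun := fun γ =>
        { verts := γ.verts
          subset := fun v hv => by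
            have h := γ.subset v hv
            rw [Finset.mem_insert] at h
            rcases h with rfl | h
            · exact absurd hv (key γ)
            · exact h
          nodup := γ.nodup
          isChain := γ.isChain
          head_mem := γ.head_mem
          getLast_mem := γ.getLast_mem
          eq_of_nil := γ.eq_of_nil
          edges_nodup := γ.edges_nodup
          fst_mem := haΛ }
      invFun := fun γ =>
        { verts := γ.verts
          subset := fun v hv => Finset.mem_insert_of_mem (γ.subset v hv)
          nodup := γ.nodup
          isChain := γ.isChain
          head_mem := γ.head_mem
          getLast_mem := γ.getLast_mem
          eq_of_nil := γ.eq_of_nil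
          edges_nodup := γ.edges_nodup
          fst_mem := by
            obtain ⟨he, v, hv, hvΛ⟩ := haΛ
            exact ⟨he, v, hv, Finset.mem_insert_of_mem hvΛ⟩ }
      left_inv := fun γ => HexMidEdgeSAW.ext rfl
      right_inv := fun γ => HexMidEdgeSAW.ext rfl }
  unfold hexParafermionicObservable
  exact Fintype.sum_equiv e _ _ fun γ => rfl

/-- **Structure of a walk to the tip `{u, t}`** (`u ∉ insert t Λ`, `t` attached only through `w`,
`t ∉ a`): it reads `…, w, t`. [folklore] -/
theorem verts_eq_of_tip (hu : u ∉ insert t Λ) (hclosed : ∀ v ∈ insert t Λ, hexGraph.Adj t v → v = w)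
    (hta : t ∉ a) (γ : HexMidEdgeSAW (insert t Λ) a s(u, t)) :
    ∃ rest : List HexVertex, γ.verts = rest ++ [w, t] := by
  have hne : γ.verts ≠ [] := fun h => hta (by rw [γ.eq_of_nil h]; exact Sym2.mem_mk_right _ _)
  -- the last vertex lies on `{u, t}` and in `insert t Λ`, hence is `t`
  have hlast : γ.verts.getLast hne = t := by
    rcases γ.getLast_eq_or hne with h | h
    · exact absurd (h ▸ γ.subset _ (List.getLast_mem hne)) hu
    · exact h
  obtain ⟨L₀, g, hLg⟩ : ∃ L₀ g, γ.verts = L₀ ++ [g] := ⟨_, _, (List.dropLast_append_getLast hne).symm⟩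
  have hg : g = t := by rw [← hlast]; simp [hLg]
  subst hg
  -- at least two vertices: otherwise the walk starts at `t ∈ a`
  rcases L₀.eq_nil_or_concat' with h₀ | ⟨rest, p, rfl⟩
  · subst h₀
    exfalso; apply hta
    apply γ.head_mem
    rw [hLg]; rfl
  · have hc := γ.isChain
    rw [hLg, List.append_assoc] at hc
    have hpt : hexGraph.Adj p g := rel_of_isChain_concat_concat rest p g hc
    have hp : p = w := hclosed p (γ.subset p (by rw [hLg]; simp)) hpt.symm
    subst hp
    exact ⟨rest, by rw [hLg, List.append_assoc]; rfl⟩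

/-- **Structure of a walk of `Λ` to the boundary mid-edge `{w, t}`** (`t ∉ Λ`, `a ≠ {w, t}`): it
reads `…, w`. [folklore] -/
theorem verts_eq_of_boundary_end (ht : t ∉ Λ) (hta : t ∉ a) (γ : HexMidEdgeSAW Λ a s(w, t)) :
    ∃ rest : List HexVertex, γ.verts = rest ++ [w] := by
  have hne : γ.verts ≠ [] := fun h => hta (by rw [γ.eq_of_nil h]; exact Sym2.mem_mk_right _ _)
  have hlast : γ.verts.getLast hne = w := by
    rcases γ.getLast_eq_or hne with h | h
    · exact h
    · exact absurd (h ▸ γ.subset _ (List.getLast_mem hne)) ht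
  obtain ⟨L₀, g, hLg⟩ : ∃ L₀ g, γ.verts = L₀ ++ [g] := ⟨_, _, (List.dropLast_append_getLast hne).symm⟩
  have hg : g = w := by rw [← hlast]; simp [hLg]
  exact ⟨L₀, by rw [hLg, hg]⟩

/-- **Peeling the tip vertex**: the parafermionic observable of `insert t Λ` at the tip mid-edge
`{u, t}` and that of `Λ` at the boundary mid-edge `{w, t}`, both from the root `a ∌ t`, agree up to the
nonzero factor `x e^{-iσθ}`, `θ` the turning angle at `t`. [folklore] -/
theorem observable_insert_tip (ht : t ∉ Λ) (hw : w ∈ Λ) (hadj_wt : hexGraph.Adj w t)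
    (hu : u ∉ insert t Λ) (hadj_tu : hexGraph.Adj t u)
    (hclosed : ∀ v ∈ insert t Λ, hexGraph.Adj t v → v = w) (hta : t ∉ a)
    (haΛ : a ∈ hexDomainMidEdges Λ) (x σ : ℝ) :
    hexParafermionicObservable (insert t Λ) a x σ s(u, t) =
      ((x : ℂ) * Complex.exp (-Complex.I * σ *
        (turning (hexCenter w) (hexCenter t) (hexMidpoint s(u, t)) : ℝ))) *
        hexParafermionicObservable Λ a x σ s(w, t) := by
  have huw : u ≠ w := fun h => hu (h ▸ Finset.mem_insert_of_mem hw)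
  have hut : u ≠ t := fun h => hadj_tu.ne h.symm
  have vEq := fun γ : HexMidEdgeSAW (insert t Λ) a s(u, t) => verts_eq_of_tip hu hclosed hta γ
  have vEq' := fun γ : HexMidEdgeSAW Λ a s(w, t) => verts_eq_of_boundary_end ht hta γ
  -- edges of a list of `Λ`-vertices never contain `t`
  have edge_no_t : ∀ (l : List HexVertex), (∀ v ∈ l, v ∈ Λ) →
      ∀ e ∈ List.zipWith (fun u w => s(u, w)) l l.tail, t ∉ e := fun l hl e he hte =>
    ht (hl t (forall_mem_of_mem_edges l e he t hte))
  -- drop the last vertex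
  let peel : HexMidEdgeSAW (insert t Λ) a s(u, t) → HexMidEdgeSAW Λ a s(w, t) := fun γ =>
    { verts := γ.verts.dropLast
      subset := fun v hv => by
        obtain ⟨rest, hr⟩ := vEq γ
        have hd : γ.verts.dropLast = rest ++ [w] := by
          rw [hr, show rest ++ [w, t] = (rest ++ [w]) ++ [t] by simp, List.dropLast_concat]
        rw [hd] at hv
        have hv' : v ∈ γ.verts := by rw [hr]; simp at hv ⊢; tauto
        have hvΛ := γ.subset v hv'
        rw [Finset.mem_insert] at hvΛ
        rcases hvΛ with rfl | h
        · exfalso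
          have hnd := γ.nodup
          rw [hr, show rest ++ [w, v] = (rest ++ [w]) ++ [v] by simp] at hnd
          exact (List.disjoint_of_nodup_append hnd) hv (List.mem_singleton_self v)
        · exact h
      nodup := γ.nodup.sublist (List.dropLast_sublist _)
      isChain := by
        obtain ⟨rest, hr⟩ := vEq γ
        have hc := γ.isChain
        rw [hr, show rest ++ [w, t] = (rest ++ [w]) ++ [t] by simp] at hc
        rw [hr, show rest ++ [w, t] = (rest ++ [w]) ++ [t] by simp, List.dropLast_concat]
        exact hc.left_of_append
      head_mem := fun v hv => by
        obtain ⟨rest, hr⟩ := vEq γ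
        apply γ.head_mem v
        rw [hr, show rest ++ [w, t] = (rest ++ [w]) ++ [t] by simp, List.dropLast_concat] at hv
        rw [hr, show rest ++ [w, t] = (rest ++ [w]) ++ [t] by simp,
          List.head?_append_of_ne_nil _ (by simp)]
        exact hv
      getLast_mem := fun v hv => by
        obtain ⟨rest, hr⟩ := vEq γ
        rw [hr, show rest ++ [w, t] = (rest ++ [w]) ++ [t] by simp, List.dropLast_concat,
          List.getLast?_append_of_ne_nil _ (List.cons_ne_nil _ _)] at hv
        simp only [List.getLast?_singleton, Option.some.injEq] at hv
        rw [← hv]; exact Sym2.mem_mk_left _ _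
      eq_of_nil := fun h => by
        obtain ⟨rest, hr⟩ := vEq γ
        rw [hr, show rest ++ [w, t] = (rest ++ [w]) ++ [t] by simp, List.dropLast_concat] at h
        simp at h
      edges_nodup := fun _ => by
        obtain ⟨rest, hr⟩ := vEq γ
        have hnd := γ.edges_nodup (by rw [hr]; simp)
        rw [hr, edges_concat_concat] at hnd
        rw [hr, show rest ++ [w, t] = (rest ++ [w]) ++ [t] by simp, List.dropLast_concat]
        -- `a :: (E ++ [{w,t}]) ++ [{u,t}]` is duplicate-free, drop the last entry
        have e1 : a :: (List.zipWith (fun u w => s(u, w)) (rest ++ [w]) (rest ++ [w]).tail ++ [s(w, t)]) ++ [s(u, t)]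
            = (a :: List.zipWith (fun u w => s(u, w)) (rest ++ [w]) (rest ++ [w]).tail ++ [s(w, t)]) ++ [s(u, t)] := by
          simp only [List.cons_append, List.append_assoc]
        rw [e1] at hnd
        exact hnd.sublist (List.sublist_append_left _ _)
      fst_mem := haΛ }
  -- append `t`
  let unpeel : HexMidEdgeSAW Λ a s(w, t) → HexMidEdgeSAW (insert t Λ) a s(u, t) := fun γ =>
    { verts := γ.verts ++ [t]
      subset := fun v hv => by
        rw [Finset.mem_insert]
        rw [List.mem_append, List.mem_singleton] at hv
        rcases hv with h | rfl
        · exact Or.inr (γ.subset v h)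
        · exact Or.inl rfl
      nodup := by
        rw [List.nodup_append]
        refine ⟨γ.nodup, List.nodup_singleton _, fun v hv s hs => ?_⟩
        rw [List.mem_singleton] at hs
        rintro rfl
        exact ht (hs ▸ γ.subset v hv)
      isChain := by
        obtain ⟨rest, hr⟩ := vEq' γ
        refine γ.isChain.append (List.isChain_singleton _) fun p hp q hq => ?_
        rw [hr, List.getLast?_append_of_ne_nil _ (List.cons_ne_nil _ _)] at hp
        simp only [List.getLast?_singleton, Option.mem_def, Option.some.injEq, List.head?_cons] at hp hq
        rw [← hp, ← hq]; exact hadj_wt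
      head_mem := fun v hv => by
        obtain ⟨rest, hr⟩ := vEq' γ
        apply γ.head_mem v
        rwa [List.head?_append_of_ne_nil _ (by rw [hr]; simp)] at hv
      getLast_mem := fun v hv => by
        rw [List.getLast?_append_of_ne_nil _ (List.cons_ne_nil _ _)] at hv
        simp only [List.getLast?_singleton, Option.some.injEq] at hv
        rw [← hv]; exact Sym2.mem_mk_right _ _
      eq_of_nil := fun h => by simp at h
      edges_nodup := fun _ => by
        obtain ⟨rest, hr⟩ := vEq' γ
        have hnd := γ.edges_nodup (by rw [hr]; simp)
        rw [hr] at hnd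
        rw [hr, show rest ++ [w] ++ [t] = rest ++ [w, t] by simp, edges_concat_concat]
        -- add `{u,t}` at the end of the duplicate-free list `a :: E ++ [{w,t}]`
        have e1 : a :: (List.zipWith (fun u w => s(u, w)) (rest ++ [w]) (rest ++ [w]).tail ++ [s(w, t)]) ++ [s(u, t)]
            = (a :: List.zipWith (fun u w => s(u, w)) (rest ++ [w]) (rest ++ [w]).tail ++ [s(w, t)]) ++ [s(u, t)] := by
          simp only [List.cons_append, List.append_assoc]
        rw [e1, List.nodup_append]
        refine ⟨hnd, List.nodup_singleton _, fun e he f hf => ?_⟩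
        rw [List.mem_singleton] at hf
        subst hf
        rw [List.cons_append, List.mem_cons, List.mem_append, List.mem_singleton] at he
        rcases he with rfl | he | rfl
        · exact fun h => hta (by rw [h]; exact Sym2.mem_mk_right _ _)
        · exact fun h => edge_no_t (rest ++ [w]) (fun v hv => γ.subset v (by rw [hr]; exact hv)) e he
            (by rw [h]; exact Sym2.mem_mk_right _ _)
        · intro h
          have : u ∈ s(w, t) := by rw [h]; exact Sym2.mem_mk_left _ _
          rcases Sym2.mem_iff.1 this with h' | h'
          · exact huw h'
          · exact hut h'
      fst_mem := by
        obtain ⟨he, v, hv, hvΛ⟩ := haΛ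
        exact ⟨he, v, hv, Finset.mem_insert_of_mem hvΛ⟩ }
  -- the bijection
  let e : HexMidEdgeSAW (insert t Λ) a s(u, t) ≃ HexMidEdgeSAW Λ a s(w, t) :=
    { toFun := peel
      invFun := unpeel
      left_inv := fun γ => by
        apply HexMidEdgeSAW.ext
        obtain ⟨rest, hr⟩ := vEq γ
        show γ.verts.dropLast ++ [t] = γ.verts
        rw [hr, show rest ++ [w, t] = (rest ++ [w]) ++ [t] by simp, List.dropLast_concat]
      right_inv := fun γ => by
        apply HexMidEdgeSAW.ext
        show (γ.verts ++ [t]).dropLast = γ.verts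
        exact List.dropLast_concat }
  -- weights scale by `x e^{-iσθ}`
  have weight_eq : ∀ γ : HexMidEdgeSAW Λ a s(w, t), (unpeel γ).weight x σ =
      ((x : ℂ) * Complex.exp (-Complex.I * σ *
        (turning (hexCenter w) (hexCenter t) (hexMidpoint s(u, t)) : ℝ))) * γ.weight x σ := by
    intro γ
    obtain ⟨rest, hr⟩ := vEq' γ
    have hlen : (unpeel γ).length = γ.length + 1 := by
      show (γ.verts ++ [t]).length = γ.verts.length + 1; simp
    have hwind : (unpeel γ).winding =
        γ.winding + turning (hexCenter w) (hexCenter t) (hexMidpoint s(u, t)) := by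
      show Polyline.winding (hexMidpoint a :: (γ.verts ++ [t]).map hexCenter ++ [hexMidpoint s(u, t)]) =
        Polyline.winding (hexMidpoint a :: γ.verts.map hexCenter ++ [hexMidpoint s(w, t)]) + _
      rw [hr]
      simp only [List.map_append, List.map_cons, List.map_nil, List.cons_append, List.append_assoc,
        List.nil_append]
      have e3 : hexMidpoint a :: (List.map hexCenter rest ++ [hexCenter w, hexCenter t, hexMidpoint s(u, t)]) =
          (hexMidpoint a :: List.map hexCenter rest) ++ [hexCenter w, hexCenter t, hexMidpoint s(u, t)] := rfl
      have e2 : hexMidpoint a :: (List.map hexCenter rest ++ [hexCenter w, hexMidpoint s(w, t)]) =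
          (hexMidpoint a :: List.map hexCenter rest) ++ [hexCenter w, hexMidpoint s(w, t)] := rfl
      rw [e3, e2, winding_concat₃]
      congr 1
      have em : hexMidpoint s(w, t) = hexCenter w + (1 / 2 : ℝ) * (hexCenter t - hexCenter w) := by
        rw [hexMidpoint_mk]; push_cast; ring
      rw [em]
      exact (winding_concat_right_ray (t := 1 / 2) (by norm_num) _ _ _).symm
    unfold HexMidEdgeSAW.weight
    rw [hlen, hwind, pow_succ]
    push_cast
    rw [show -Complex.I * σ * ((γ.winding : ℂ) +
        (turning (hexCenter w) (hexCenter t) (hexMidpoint s(u, t)) : ℂ)) =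
        -Complex.I * σ * (γ.winding : ℂ) +
        -Complex.I * σ * (turning (hexCenter w) (hexCenter t) (hexMidpoint s(u, t)) : ℂ) by ring,
      Complex.exp_add]
    ring
  -- sum over the bijection
  unfold hexParafermionicObservable
  rw [Finset.mul_sum]
  refine Fintype.sum_equiv e _ _ fun γ => ?_
  have hγ : γ = unpeel (e γ) := (e.left_inv γ).symm
  conv_lhs => rw [hγ]
  exact weight_eq _

end PeelEnd


end Summit.CriticalPhenomena.SAWScalingLimit.Theorems.BoundaryClosureR.Negative
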